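import Summits.BirchSwinnertonDyer.Rank1Residual.Additive.CyclotomicSubfields
import Mathlib.NumberTheory.NumberField.Cyclotomic.Ideal
import HarnessLib

/-!
# X3, the DEGENERATE rows, class-level count: TOTAL RAMIFICATION of `p` in every number field mapping
# into `ℚ(ζ_{p^{k+1}})` — `e(w|p) = [K : ℚ]` for every prime `w ∣ p` (cell `bsd-eis`, seat `bsd-eis-x3`
# gen 9; brick G3a of x3-MEMO-11, the prime-power form of gen 5's
# `ramificationIdx_eq_finrank_of_intermediateField_cyclotomic` (`CyclotomicSubfields.lean`, `k = 0`);
# route K1 `AdditiveBranchIMC`, crux `GordTwoRankZeroOffCaseOne` — supports only)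

HONEST FRAMING (`run/shared/lean/pub/bsd-eis/README.md` §4): THEOREMS ONLY (no `def`, no named fact,
no `sorry`); nothing is booked; no label, tier or count of record moves.

## What / why
The layers `ℚ_N` of the cyclotomic `ℤ₃`-tower sit inside `ℚ(ζ_{3^{N+1}})` (tree
`ZpExtension.IsCyclotomic.rootsOfUnityFixer_le_layerSubgroup`); the class-level U-side count needs
every prime of `ℚ_N` above `3` to have ODD ramification index (`X3BranchCubesModNine.lean`). This file
proves, for ANY number field `K` with an algebra map into a `p^{k+1}`-th cyclotomic field `L`:
* `KummerFamily.ramificationIdx'_eq_finrank_of_algebra_cyclotomic` — `e(w|p) = [K : ℚ]` for every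
  `w ∣ p` of `K` (tower `e(𝔓|p) = e(w|p)·e(𝔓|w)` with `e(𝔓|p) = p^k(p−1) = [L:ℚ] = [K:ℚ][L:K]`, Mathlib
  `IsCyclotomicExtension.Rat.ramificationIdx_eq_of_prime_pow`, and the two bounds `e ≤ degree`).
So for `K = ℚ_N ⊂ ℚ(ζ_{3^{N+1}})`: `e(w|3) = 3^N`, odd.
References: [Washington1997] Lemma 1.4, Prop. 2.3, §13.1; [NeukirchANT1999] Ch. I (8.2).
-/

set_option autoImplicit false

noncomputable section

open scoped Classical NumberField

namespace Summit.BirchSwinnertonDyer.Rank1Residual.Additive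

namespace KummerFamily

open NumberField IsDedekindDomain

variable {L : Type} [Field L] [NumberField L] (p k : ℕ) [hp : Fact p.Prime]
  [hcyc : IsCyclotomicExtension {p ^ (k + 1)} ℚ L]
  (K : Type) [Field K] [NumberField K] [Algebra K L]

include hcyc in
/-- **Every number field `K` mapping into `ℚ(ζ_{p^{k+1}})` is totally ramified at `p`:
`e(w|p) = [K : ℚ]`** for every prime `w ∣ p` of `K`. [cite: Washington1997, Lemma 1.4 and Prop. 2.3] -/
theorem ramificationIdx'_eq_finrank_of_algebra_cyclotomic
    (w : HeightOneSpectrum (𝓞 K)) [hw : w.asIdeal.LiesOver (Ideal.span {(p : ℤ)})] :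
    (Ideal.span {(p : ℤ)}).ramificationIdx' w.asIdeal = Module.finrank ℚ K := by
  haveI : Module.Finite K L := Module.Finite.of_restrictScalars_finite ℚ K L
  haveI := w.isMaximal
  have hpmax : (Ideal.span {(p : ℤ)}).IsMaximal :=
    Ideal.IsPrime.isMaximal
      ((Ideal.span_singleton_prime (by exact_mod_cast hp.out.ne_zero)).mpr
        (Nat.prime_iff_prime_int.mp hp.out))
      (by rw [Ne, Ideal.span_singleton_eq_bot]; exact_mod_cast hp.out.ne_zero)
  haveI := hpmax
  obtain ⟨Q, hQmax, hQover⟩ :=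
    Ideal.exists_maximal_ideal_liesOver_of_isIntegral (S := 𝓞 L) w.asIdeal
  haveI := hQover
  haveI : Q.IsPrime := hQmax.isPrime
  haveI : Q.LiesOver (Ideal.span {(p : ℤ)}) := Ideal.LiesOver.trans Q w.asIdeal _
  have hpbot : Ideal.span {(p : ℤ)} ≠ ⊥ := by
    rw [Ne, Ideal.span_singleton_eq_bot]; exact_mod_cast hp.out.ne_zero
  -- `e(𝔓|p) = p^k (p − 1) = [L : ℚ]`
  have heL : (Ideal.span {(p : ℤ)}).ramificationIdx' Q = p ^ k * (p - 1) := by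
    rw [Ideal.ramificationIdx'_eq_ramificationIdx _ _ hpbot,
      IsCyclotomicExtension.Rat.ramificationIdx_eq_of_prime_pow p k L Q]
  have hL : Module.finrank ℚ L = p ^ k * (p - 1) := by
    rw [IsCyclotomicExtension.finrank (n := p ^ (k + 1)) L
        (Polynomial.cyclotomic.irreducible_rat (pow_pos hp.out.pos (k + 1))),
      Nat.totient_prime_pow_succ hp.out]
  -- tower `e(𝔓|p) = e(w|p)·e(𝔓|w)`
  have hg0 : Ideal.map (algebraMap (𝓞 K) (𝓞 L)) w.asIdeal ≠ ⊥ := by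
    rw [Ne, Ideal.map_eq_bot_iff_of_injective (RingOfIntegers.algebraMap.injective K L)]
    exact w.ne_bot
  have hfg : Ideal.map (algebraMap ℤ (𝓞 L)) (Ideal.span {(p : ℤ)}) ≠ ⊥ :=
    Ideal.map_ne_bot_of_ne_bot hpbot
  have hg : Ideal.map (algebraMap (𝓞 K) (𝓞 L)) w.asIdeal ≤ Q :=
    Ideal.map_le_iff_le_comap.mpr (le_of_eq hQover.over)
  have htower := Ideal.ramificationIdx'_algebra_tower (p := Ideal.span {(p : ℤ)}) hg0 hfg hg
  -- the two bounds from the fundamental identity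
  haveI : NoZeroSMulDivisors (𝓞 K) (𝓞 L) := ⟨fun {a x} h => by
    rw [Algebra.smul_def, mul_eq_zero] at h
    rcases h with h | h
    · exact Or.inl (RingOfIntegers.algebraMap.injective K L (by rw [h, map_zero]))
    · exact Or.inr h⟩
  have h1 : (Ideal.span {(p : ℤ)}).ramificationIdx' w.asIdeal ≤ Module.finrank ℚ K :=
    Ideal.ramificationIdx_le_finrank (𝓞 K) ℚ K w.asIdeal (p := Ideal.span {(p : ℤ)})
  have h2 : w.asIdeal.ramificationIdx' Q ≤ Module.finrank K L :=
    Ideal.ramificationIdx_le_finrank (𝓞 L) K L Q (p := w.asIdeal)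
  have hKL : Module.finrank ℚ K * Module.finrank K L = Module.finrank ℚ L :=
    Module.finrank_mul_finrank ℚ K L
  have hprod : (Ideal.span {(p : ℤ)}).ramificationIdx' w.asIdeal * w.asIdeal.ramificationIdx' Q =
      Module.finrank ℚ K * Module.finrank K L := by rw [← htower, heL, hKL, hL]
  have hpos2 : 0 < w.asIdeal.ramificationIdx' Q :=
    Nat.pos_of_ne_zero (Ideal.IsDedekindDomain.ramificationIdx'_ne_zero_of_liesOver Q w.ne_bot)
  by_contra hne
  have hlt : (Ideal.span {(p : ℤ)}).ramificationIdx' w.asIdeal < Module.finrank ℚ K :=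
    lt_of_le_of_ne h1 hne
  have : (Ideal.span {(p : ℤ)}).ramificationIdx' w.asIdeal * w.asIdeal.ramificationIdx' Q <
      Module.finrank ℚ K * Module.finrank K L :=
    calc (Ideal.span {(p : ℤ)}).ramificationIdx' w.asIdeal * w.asIdeal.ramificationIdx' Q
        < Module.finrank ℚ K * w.asIdeal.ramificationIdx' Q := Nat.mul_lt_mul_of_pos_right hlt hpos2
      _ ≤ Module.finrank ℚ K * Module.finrank K L := Nat.mul_le_mul_left _ h2
  omega

end KummerFamily

end Summit.BirchSwinnertonDyer.Rank1Residual.Additive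

end
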